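import Summits.QuantumFields.BalabanUV.Beta.EriceRemainderEnclosureHistoryAutonomyComparisonAgeCompositionThreeAgesDefectAbs
import Summits.QuantumFields.BalabanUV.Beta.EriceRemainderEnclosureHistoryAutonomyComparisonAgeCompositionDecayBudget

/-!
# EriceRemainderEnclosureHistoryAutonomyComparisonAgeCompositionThreeAgesFlowReads — (E88d) route (N), first order: the DOMINATION READS along a flow with
# ANY load profile — every level step dominates the FULL read sum one pin deeper (`y_p ≥ h_{p+1}²·Σ_j L_j h_{p+1+j}`), every rise dominates the full read sums over
# its stretch, and the total load two pins deeper is at most half the step; in the three-age letters `y_p ≥ 2d_{p+1}ρ¹_p + 2q_{p+1}ρ²_p + 2c_{p+1}ρ³_p` —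
# the credits of the B-budget of (E88c) (the two-age versions are (E84c) `step_ge_reads` ∕ (E84d) `rise_ge_window_reads`)

Cell `pub-balaban`, β-function sub-cell, BINDER row D4 «RemainderConst leaves for Bałaban's split» (`HOME/BINDER-OWNERS.md`; owner lineage `b2b-balaban-beta-an4`;
this file by co-owner #2 lineage `b2b-balaban-beta-d4-p2`, generation 79), β-FLOW TEAM duty (1), FREEZE (0) honoured (def-free; imports (E87p), (E84b); uses
(E79) `strictAnti_of_memFlow`, `seqBox_shift` BY NAME; nothing restated — the two-age statements of (E84c)∕(E84d) are the special cases `{1,k}` of §1–§2).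

HONEST FRAMING (page 1, verbatim and binding).  *"Discharging BetaPertH makes Bałaban's UV stability UNCONDITIONAL — a real constructive-QFT result; it is
NOT the continuum limit and NOT the Clay problem."*  THIS FILE DISCHARGES NOTHING OF THE KIND.  Elementary real analysis about ABSTRACT functionals on a box
]0,γ]^ℕ with displayed floors and profiles — hypotheses of a census, not facts; the form, signs, ages and moments of Bałaban's (1.22) limit functional are NOT
PRINTED ([I] p. 298; GAPS G-t4-U2-1∕-2) and NOT asserted.  Row D4 class UNCHANGED (critical-path width 0; instance 0∕1; D4 DISCHARGE NO DATE).  HONEST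
DEPENDENCY: continuum YM on T⁴ ⇐ BetaPertH ∧ nine spine estimates (0/9 proved); BetaPertH ⇐ (D1) ∧ (D4) ∧ CAP+tail; G-an2-4 gates asym, D1 and NE2/3/4.

THE POINT (census sense (α); route (N); README `HOME/b2b-balaban-beta-d4-p2/g79/e88/README.md` §4).  The B-budget of (E88c) is paid by the young decay across
the old window, `Σ (3∕2)(y_p + y_p²∕2)` over `p ∈ [m+1+l'+k₂, m+k₃+k₂]`, weighted `(i+1)∕k₃`; along a flow each level step is a domination read:
`y_p = h_{p+1}²·B(h(p+1+·)) ≥ h_{p+1}²·Σ_{j<K} L_j h_{p+1+j}`.  §1 **`step_ge_all_reads`** (any profile), **`step_ge_reads_three`** (the three loaded ages in the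
census letters `d`, `q`, `c` with the level ratios `(h_{p+1}∕h_{p+1+j})²`, every other age dropped); §2 **`invSq_sub_ge_all_reads`**, **`rise_ge_all_reads`**
(the rise across `j` scales dominates the full read sums over them); §3 **`loads_le_half_step`** (`F_{n+1} − L_0h_{n+1}³∕2 ≤ y_n∕2`: every age `j ≥ 1` two
pins deeper reads a level below `h_{n+1}`; the two-age case is (E84c) `reads_le_half_step`).  NOT CLAIMED: the B-budget along flows (successor); anything
nonlinear; anything printed — NOT B12 Thm 2, NOT BetaPertH.

WHAT IS PROVED ([folklore]; 0 `def`, 0 sorry).  §1 **`step_ge_all_reads`**, **`step_ge_reads_three`**; §2 **`invSq_sub_ge_all_reads`**, **`rise_ge_all_reads`**;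
§3 **`loads_le_half_step`**.
-/
noncomputable section
open Finset

namespace Summit.QuantumFields.BalabanUV.Beta.EriceRemainderEnclosureHistoryAutonomyComparisonAgeCompositionThreeAgesFlowReads

open Literature.MathematicalPhysics.QuantumFieldTheory.Balaban1983to89
open Literature.MathematicalPhysics.QuantumFieldTheory.Balaban1983to89.T4BetaStationary
open Literature.MathematicalPhysics.QuantumFieldTheory.Balaban1983to89.T4BetaFlowWellPosed
open Summit.QuantumFields.BalabanUV.Beta.EriceRemainderEnclosureHistoryAutonomyOrder (strictAnti_of_memFlow)

variable {B : (ℕ → ℝ) → ℝ} {γ b gIR : ℝ} {L : ℕ → ℝ} {K : ℕ} {h : ℕ → ℝ}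

/-! ## §1 Every level step dominates the full read sum one pin deeper -/

/-- **THE STEP DOMINATES ALL READS.**  Along a box solution of an isotone memory dominated by the profile `L ≥ 0`: `h_{p+1}²·Σ_{j<K} L_jh_{p+1+j} ≤
1 − (h_{p+1}∕h_p)²` — the level step `1∕h_{p+1}² − 1∕h_p² = B(h(p+1+·))` is at least the profile read of the shifted history. [folklore] -/
theorem step_ge_all_reads (hdom : ∀ u, SeqBox γ u → ∑ k ∈ range K, L k * u k ≤ B u) (hh : SeqBox γ h) (hf : MemFlow B gIR h) (p : ℕ) :
    h (p + 1) ^ 2 * ∑ j ∈ range K, L j * h (p + 1 + j) ≤ 1 - (h (p + 1) / h p) ^ 2 := by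
  have hpos : ∀ n, 0 < h n := fun n => (hh n).1
  have hp := hpos p; have hp1 := hpos (p + 1)
  have e1 := hf.2 p
  have hdomB : ∑ j ∈ range K, L j * h (p + 1 + j) ≤ B (fun j => h (p + 1 + j)) := hdom _ (seqBox_shift hh (p + 1))
  have hstep : h (p + 1) ^ 2 * B (fun j => h (p + 1 + j)) = 1 - (h (p + 1) / h p) ^ 2 := by
    rw [show B (fun j => h (p + 1 + j)) = 1 / h (p + 1) ^ 2 - 1 / h p ^ 2 by linarith [e1], div_pow]; field_simp
  have := mul_le_mul_of_nonneg_left hdomB (le_of_lt (pow_pos hp1 2))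
  rw [hstep] at this
  exact this

/-- **THE STEP DOMINATES THE THREE LOADED AGES' READS, IN THE CENSUS LETTERS.**  Ages `1 < k₂ < k₃ < K`, `d_n = L_1h_{n+1}³∕2`, `q_n = L_{k₂}h_{n+k₂}³∕2`,
`c_n = L_{k₃}h_{n+k₃}³∕2`: `2d_{p+1}·(h_{p+1}∕h_{p+2})² + 2q_{p+1}·(h_{p+1}∕h_{p+1+k₂})² + 2c_{p+1}·(h_{p+1}∕h_{p+1+k₃})² ≤ 1 − (h_{p+1}∕h_p)²` (the other
ages' reads dropped, `L ≥ 0`). [folklore] -/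
theorem step_ge_reads_three (hL : ∀ k, 0 ≤ L k) (hdom : ∀ u, SeqBox γ u → ∑ k ∈ range K, L k * u k ≤ B u) (hh : SeqBox γ h) (hf : MemFlow B gIR h)
    {k₂ k₃ : ℕ} (hk2 : 2 ≤ k₂) (hk23 : k₂ < k₃) (hk3K : k₃ < K)
    {d q c : ℕ → ℝ} (hd : ∀ n, d n = L 1 * h (n + 1) ^ 3 / 2) (hq : ∀ n, q n = L k₂ * h (n + k₂) ^ 3 / 2) (hc : ∀ n, c n = L k₃ * h (n + k₃) ^ 3 / 2)
    (p : ℕ) :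
    2 * d (p + 1) * (h (p + 1) / h (p + 2)) ^ 2 + 2 * q (p + 1) * (h (p + 1) / h (p + 1 + k₂)) ^ 2 + 2 * c (p + 1) * (h (p + 1) / h (p + 1 + k₃)) ^ 2 ≤
      1 - (h (p + 1) / h p) ^ 2 := by
  have hpos : ∀ n, 0 < h n := fun n => (hh n).1
  have hall := step_ge_all_reads hdom hh hf p
  have hsub : ({1, k₂, k₃} : Finset ℕ) ⊆ range K := by
    intro j hj
    simp only [mem_insert, mem_singleton] at hj
    rw [mem_range]; rcases hj with rfl | rfl | rfl <;> omega
  have hthree : L 1 * h (p + 1 + 1) + (L k₂ * h (p + 1 + k₂) + L k₃ * h (p + 1 + k₃)) ≤ ∑ j ∈ range K, L j * h (p + 1 + j) := by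
    have := sum_le_sum_of_subset_of_nonneg hsub (f := fun j => L j * h (p + 1 + j)) (fun j _ _ => mul_nonneg (hL j) (hpos _).le)
    rwa [sum_insert (by simp only [mem_insert, mem_singleton]; omega), sum_pair (by omega)] at this
  have e : 2 * d (p + 1) * (h (p + 1) / h (p + 2)) ^ 2 + 2 * q (p + 1) * (h (p + 1) / h (p + 1 + k₂)) ^ 2 + 2 * c (p + 1) * (h (p + 1) / h (p + 1 + k₃)) ^ 2
      = h (p + 1) ^ 2 * (L 1 * h (p + 1 + 1) + (L k₂ * h (p + 1 + k₂) + L k₃ * h (p + 1 + k₃))) := by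
    rw [hd, hq, hc, show p + 1 + 1 = p + 2 by ring]
    have h2 := hpos (p + 2); have h3 := hpos (p + 1 + k₂); have h4 := hpos (p + 1 + k₃)
    field_simp
    ring
  rw [e]
  exact (mul_le_mul_of_nonneg_left hthree (pow_pos (hpos _) 2).le).trans hall

/-! ## §2 Every rise dominates the full read sums over its stretch -/

/-- **THE RISE ACROSS `j` SCALES DOMINATES ALL READS OVER THEM**: `Σ_{q<j} Σ_{i<K} L_ih_{n+q+1+i} ≤ 1∕h_{n+j}² − 1∕h_n²`. [folklore] -/
theorem invSq_sub_ge_all_reads (hdom : ∀ u, SeqBox γ u → ∑ k ∈ range K, L k * u k ≤ B u) (hh : SeqBox γ h) (hf : MemFlow B gIR h) (n j : ℕ) :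
    ∑ q ∈ range j, ∑ i ∈ range K, L i * h (n + q + 1 + i) ≤ 1 / h (n + j) ^ 2 - 1 / h n ^ 2 := by
  have hstep : ∀ q, ∑ i ∈ range K, L i * h (n + q + 1 + i) ≤ 1 / h (n + q + 1) ^ 2 - 1 / h (n + q) ^ 2 := by
    intro q
    have e1 := hf.2 (n + q)
    have hdomB : ∑ i ∈ range K, L i * h (n + q + 1 + i) ≤ B (fun i => h (n + q + 1 + i)) := hdom _ (seqBox_shift hh (n + q + 1))
    linarith
  calc ∑ q ∈ range j, ∑ i ∈ range K, L i * h (n + q + 1 + i)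
      ≤ ∑ q ∈ range j, (1 / h (n + (q + 1)) ^ 2 - 1 / h (n + q) ^ 2) := sum_le_sum fun q _ => by rw [show n + (q + 1) = n + q + 1 by ring]; exact hstep q
    _ = 1 / h (n + j) ^ 2 - 1 / h n ^ 2 := by rw [sum_range_sub (fun q => 1 / h (n + q) ^ 2)]; simp

/-- The same multiplied by `h_n²`: `h_n²·Σ_{q<j} Σ_{i<K} L_ih_{n+q+1+i} ≤ (h_n∕h_{n+j})² − 1` — the rise across the stretch in the census letters. [folklore] -/
theorem rise_ge_all_reads (hdom : ∀ u, SeqBox γ u → ∑ k ∈ range K, L k * u k ≤ B u) (hh : SeqBox γ h) (hf : MemFlow B gIR h) (n j : ℕ) :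
    h n ^ 2 * ∑ q ∈ range j, ∑ i ∈ range K, L i * h (n + q + 1 + i) ≤ (h n / h (n + j)) ^ 2 - 1 := by
  have hpos : ∀ n, 0 < h n := fun n => (hh n).1
  have hn := hpos n; have hnj := hpos (n + j)
  have h1 := invSq_sub_ge_all_reads hdom hh hf n j
  have e : h n ^ 2 * (1 / h (n + j) ^ 2 - 1 / h n ^ 2) = (h n / h (n + j)) ^ 2 - 1 := by rw [div_pow]; field_simp
  rw [← e]
  exact mul_le_mul_of_nonneg_left h1 (le_of_lt (pow_pos hn 2))

/-! ## §3 The loads two pins deeper are at most half the step -/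

/-- **THE LOADS OF THE AGES `≥ 1` TWO PINS DEEPER ARE AT MOST HALF THE STEP**: `Σ_{1≤j<K} L_jh_{n+1+j}³∕2 ≤ (1 − (h_{n+1}∕h_n)²)∕2` — every such age reads, in
the step at `n`, a level `h_{n+1+j} ≤ h_{n+1}` (`h` non-increasing), so `L_jh_{n+1+j}³ ≤ h_{n+1}²·L_jh_{n+1+j}`.  With `F_t = Σ_{j<K} L_jh_{t+j}³∕2` this is
`F_{n+1} − L_0h_{n+1}³∕2 ≤ y_n∕2`. [folklore] -/
theorem loads_le_half_step (hL : ∀ k, 0 ≤ L k) (hb : 0 < b) (hlo : ∀ u, SeqBox γ u → b ≤ B u) (hdom : ∀ u, SeqBox γ u → ∑ k ∈ range K, L k * u k ≤ B u)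
    (hh : SeqBox γ h) (hf : MemFlow B gIR h) (n : ℕ) :
    ∑ j ∈ range K, (if 1 ≤ j then L j * h (n + 1 + j) ^ 3 / 2 else 0) ≤ (1 - (h (n + 1) / h n) ^ 2) / 2 := by
  have hpos : ∀ n, 0 < h n := fun n => (hh n).1
  have hanti := (strictAnti_of_memFlow hb hlo hh hf).antitone
  have hall := step_ge_all_reads hdom hh hf n
  have hterm : ∀ j ∈ range K, (if 1 ≤ j then L j * h (n + 1 + j) ^ 3 / 2 else 0) ≤ h (n + 1) ^ 2 * (L j * h (n + 1 + j)) / 2 := by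
    intro j _
    split_ifs with hj
    · have hle : h (n + 1 + j) ≤ h (n + 1) := hanti (by omega)
      have h0 := hpos (n + 1 + j)
      have : h (n + 1 + j) ^ 2 ≤ h (n + 1) ^ 2 := pow_le_pow_left₀ h0.le hle 2
      have hLj := hL j
      nlinarith [mul_nonneg hLj h0.le]
    · have := hL j; have := hpos (n + 1 + j); have := hpos (n + 1); positivity
  calc ∑ j ∈ range K, (if 1 ≤ j then L j * h (n + 1 + j) ^ 3 / 2 else 0)
      ≤ ∑ j ∈ range K, h (n + 1) ^ 2 * (L j * h (n + 1 + j)) / 2 := sum_le_sum hterm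
    _ = (h (n + 1) ^ 2 * ∑ j ∈ range K, L j * h (n + 1 + j)) / 2 := by rw [mul_sum, sum_div]
    _ ≤ (1 - (h (n + 1) / h n) ^ 2) / 2 := by linarith

end Summit.QuantumFields.BalabanUV.Beta.EriceRemainderEnclosureHistoryAutonomyComparisonAgeCompositionThreeAgesFlowReads

end
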